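import Mathlib.Analysis.SpecialFunctions.Pow.Real
import Literature.Computability.Complexity.RandomCNF
import HarnessLib

/-!
# Scope expansion of CNFs (unique-neighbour / cover expansion) and the KMOW random-graph theorem

Trunk Literature/Computability/MetaComplexity. Support file for the discharge of the named fact
`kmow_sos_random_kSAT` (`SumOfSquares.lean`, Kothari–Mori–O'Donnell–Witmer 2017, Thm. 7.1): the
probabilistic half of that theorem is a statement about the FACTOR GRAPH of the random formula
only, which we isolate here.

* `clauseScope C` — the set of variables of a clause; `cnfScopes φ : Fin φ.length → Finset ℕ` — the
  family of scopes of a CNF indexed by clause POSITIONS (a random formula may repeat a clause).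
* For a family of finite sets `S : ι → Finset ℕ` and a finite family of indices `F`:
  `cover S F = ⋃_{i ∈ F} S i`, `boundary S F` = the points lying in EXACTLY ONE `S i`, `i ∈ F`
  (unique neighbours); `IsCoverExpander S r a` — every `F` with `|F| ≤ r` has `|cover| ≥ a |F|`;
  `IsBoundaryExpander S r c` — every `F` with `|F| ≤ r` has `|boundary| ≥ c |F|`
  (Ben-Sasson–Wigderson's `(r, c)`-boundary expansion of the clause/variable graph).
* `IsCoverExpander.isBoundaryExpander` — the double-counting passage: scopes of size `≤ k` and
  cover expansion `a = (k + c)/2` give boundary expansion `c`.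
* `kmow_random_kCNF_plausible` — NAMED FACT, KMOW 2017 Thm. 4.12 (first claim, proved in their
  Appendix A) specialised to `k`-SAT (`τ = K = k`, `λ = k - 2`): for a `τ`-subgraph with `τ = k` all
  `k` edges of each of its constraints are present, so the Plausibility Assumption
  "`(τ - ζ) c ≥ 2 (e - v)` for all `τ`-subgraphs with `c ≤ 2·SMALL` constraints" (Notation 2.5,
  Lemma 4.11) reads: every family `F` of at most `2·SMALL` clause positions covers at least
  `(k + ζ)|F|/2` variables, i.e. `IsCoverExpander (cnfScopes φ) (2·SMALL) ((k+ζ)/2)`.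

Nothing probabilistic is proved here; the fact is discharged separately.

## References

* P. K. Kothari, R. Mori, R. O'Donnell, D. Witmer, *Sum of squares lower bounds for refuting any
  CSP*, STOC 2017, arXiv:1701.04521: Notation 2.5 (parameters `SMALL`, `ζ`, `K ≤ ζ·SMALL`), §2.2
  (Plausibility Assumption), Def. 4.5, Def. 4.8–4.9, Lemma 4.11, Thm. 4.12 (random factor graphs are
  plausible; proof in Appendix A).
* E. Ben-Sasson, A. Wigderson, *Short proofs are narrow — resolution made simple*, J. ACM 48 (2001),
  §5–6 (boundary expansion of random `k`-CNFs).
-/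

noncomputable section

open Finset Literature.Computability.Complexity

namespace Literature.Computability.MetaComplexity

/-! ### Scopes -/

/-- The SCOPE of a clause: the finite set of variables occurring in it.
[Kothari–Mori–O'Donnell–Witmer 2017, §1.1 ("a scope of `k` distinct variables")] [folklore] -/
def clauseScope (C : Clause ℕ) : Finset ℕ :=
  (C.map Prod.fst).toFinset

/-- The family of scopes of a CNF, indexed by clause positions `Fin φ.length` (positions, not
clauses: a formula drawn with replacement may repeat a clause, and the two copies are two
constraint-vertices of the factor graph). [Kothari–Mori–O'Donnell–Witmer 2017, Notation 2.4
(factor graph)] [folklore] -/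
def cnfScopes (φ : CNF ℕ) : Fin φ.length → Finset ℕ :=
  fun i => clauseScope φ[i]

/-- Membership in the scope. [folklore] -/
theorem mem_clauseScope {C : Clause ℕ} {v : ℕ} : v ∈ clauseScope C ↔ ∃ b, (v, b) ∈ C := by
  simp [clauseScope]

/-- A scope has at most as many variables as the clause has literals. [folklore] -/
theorem card_clauseScope_le (C : Clause ℕ) : (clauseScope C).card ≤ C.length := by
  unfold clauseScope
  exact (List.toFinset_card_le _).trans (by rw [List.length_map])

/-- For a clause on pairwise distinct variables the scope has exactly `|C|` elements. [folklore] -/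
theorem card_clauseScope_of_nodup {C : Clause ℕ} (h : (C.map Prod.fst).Nodup) :
    (clauseScope C).card = C.length := by
  rw [clauseScope, List.toFinset_card_of_nodup h, List.length_map]

/-! ### Cover and boundary of a family of scopes -/

section Expansion

variable {ι : Type*} (S : ι → Finset ℕ)

/-- The COVER of a family of indices: all points of the scopes `S i`, `i ∈ F` (the variable-vertices
of the sub-factor-graph spanned by the constraints in `F`). [Kothari–Mori–O'Donnell–Witmer 2017,
Notation 4.2 (`vbls(H)`)] [folklore] -/
def cover (F : Finset ι) : Finset ℕ :=
  F.biUnion S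

/-- The number of scopes of the family containing the point `v`. [folklore] -/
def coverDegree [DecidableEq ι] (F : Finset ι) (v : ℕ) : ℕ :=
  (F.filter fun i => v ∈ S i).card

/-- The BOUNDARY (unique-neighbour set) of a family of indices: the points lying in exactly one
scope `S i`, `i ∈ F`. [Ben-Sasson–Wigderson 2001, §5 (boundary `∂`)] [folklore] -/
def boundary [DecidableEq ι] (F : Finset ι) : Finset ℕ :=
  (cover S F).filter fun v => coverDegree S F v = 1

/-- COVER (vertex) EXPANSION: every family of at most `r` indices covers at least `a` points per
index. For `k`-uniform scopes and `a = (k + ζ)/2` this is KMOW's Plausibility Assumption for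
`τ = k`. [Kothari–Mori–O'Donnell–Witmer 2017, §2.2 with Lemma 4.11] [folklore] -/
def IsCoverExpander (r a : ℝ) : Prop :=
  ∀ F : Finset ι, (F.card : ℝ) ≤ r → a * F.card ≤ ((cover S F).card : ℝ)

/-- BOUNDARY EXPANSION: every family of at most `r` indices has at least `c` unique-neighbour
points per index. [Ben-Sasson–Wigderson 2001, §5–6 (`(r, c)`-boundary expander)] [folklore] -/
def IsBoundaryExpander [DecidableEq ι] (r c : ℝ) : Prop :=
  ∀ F : Finset ι, (F.card : ℝ) ≤ r → c * F.card ≤ ((boundary S F).card : ℝ)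

variable {S}

/-- Membership in the cover. [folklore] -/
theorem mem_cover {F : Finset ι} {v : ℕ} : v ∈ cover S F ↔ ∃ i ∈ F, v ∈ S i := by
  simp [cover]

/-- Each scope of the family lies in the cover. [folklore] -/
theorem subset_cover {F : Finset ι} {i : ι} (hi : i ∈ F) : S i ⊆ cover S F :=
  Finset.subset_biUnion_of_mem S hi

variable [DecidableEq ι]

/-- Membership in the boundary. [folklore] -/
theorem mem_boundary {F : Finset ι} {v : ℕ} :
    v ∈ boundary S F ↔ v ∈ cover S F ∧ coverDegree S F v = 1 := by
  simp [boundary]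

/-- The boundary lies in the cover. [folklore] -/
theorem boundary_subset_cover (F : Finset ι) : boundary S F ⊆ cover S F :=
  Finset.filter_subset _ _

/-- A boundary point lies in exactly one scope of the family. [folklore] -/
theorem existsUnique_of_mem_boundary {F : Finset ι} {v : ℕ} (hv : v ∈ boundary S F) :
    ∃! i, i ∈ F ∧ v ∈ S i := by
  rw [mem_boundary, coverDegree, Finset.card_eq_one] at hv
  obtain ⟨-, i, hi⟩ := hv
  refine ⟨i, ?_, fun j hj => ?_⟩
  · have : i ∈ F.filter fun i => v ∈ S i := by rw [hi]; exact mem_singleton_self i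
    simpa using this
  · have : j ∈ F.filter fun i => v ∈ S i := by simpa using hj
    rw [hi] at this
    simpa using this

/-- A covered point has positive degree. [folklore] -/
theorem one_le_coverDegree {F : Finset ι} {v : ℕ} (hv : v ∈ cover S F) : 1 ≤ coverDegree S F v := by
  obtain ⟨i, hi, hv⟩ := mem_cover.1 hv
  exact Finset.card_pos.2 ⟨i, by simp [hi, hv]⟩

/-- Double counting: the degrees over the cover add up to the total size of the scopes. [folklore] -/
theorem sum_coverDegree (F : Finset ι) :
    ∑ v ∈ cover S F, coverDegree S F v = ∑ i ∈ F, (S i).card := by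
  unfold coverDegree
  simp_rw [Finset.card_filter]
  rw [Finset.sum_comm]
  refine Finset.sum_congr rfl fun i hi => ?_
  rw [← Finset.card_filter, Finset.filter_mem_eq_inter, Finset.inter_eq_right.2 (subset_cover hi)]

/-- The unique-neighbour count from the cover: `2 |cover F| ≤ |∂F| + Σ_{i ∈ F} |S i|` (points of
the cover outside the boundary are counted at least twice). [Ben-Sasson–Wigderson 2001, §6;
Kothari–Mori–O'Donnell–Witmer 2017, Lemma 4.11] [folklore] -/
theorem two_mul_card_cover_le (F : Finset ι) :
    2 * (cover S F).card ≤ (boundary S F).card + ∑ i ∈ F, (S i).card := by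
  rw [← sum_coverDegree]
  have h1 : ∑ v ∈ cover S F, (if coverDegree S F v = 1 then 1 else 2) ≤
      ∑ v ∈ cover S F, coverDegree S F v := by
    refine Finset.sum_le_sum fun v hv => ?_
    split_ifs with h
    · omega
    · have := one_le_coverDegree hv; omega
  have h2 : ∑ v ∈ cover S F, (if coverDegree S F v = 1 then 1 else 2) =
      (boundary S F).card + 2 * ((cover S F).filter fun v => ¬ coverDegree S F v = 1).card := by
    rw [Finset.sum_ite, Finset.sum_const, Finset.sum_const, smul_eq_mul, smul_eq_mul, mul_one,
      mul_comm]
    rfl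
  have h3 : (boundary S F).card + ((cover S F).filter fun v => ¬ coverDegree S F v = 1).card =
      (cover S F).card :=
    Finset.card_filter_add_card_filter_not _
  omega

/-- **Cover expansion gives boundary expansion.** If every scope has at most `k` points and every
family of `≤ r` indices covers `≥ (k + c)/2` points per index, then every such family has `≥ c`
unique-neighbour points per index. [Ben-Sasson–Wigderson 2001, §6 (proof of Lemma 6.2);
Kothari–Mori–O'Donnell–Witmer 2017, Lemma 4.11] [folklore] -/
theorem IsCoverExpander.isBoundaryExpander {k : ℕ} {r c : ℝ} (hk : ∀ i, (S i).card ≤ k)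
    (h : IsCoverExpander S r ((k + c) / 2)) : IsBoundaryExpander S r c := by
  intro F hF
  have h1 := h F hF
  have h2 := two_mul_card_cover_le (S := S) F
  have h3 : ∑ i ∈ F, (S i).card ≤ k * F.card := by
    calc ∑ i ∈ F, (S i).card ≤ ∑ i ∈ F, k := Finset.sum_le_sum fun i _ => hk i
      _ = k * F.card := by rw [Finset.sum_const, smul_eq_mul, mul_comm]
  have h4 : ((2 * (cover S F).card : ℕ) : ℝ) ≤ ((boundary S F).card + k * F.card : ℕ) := by
    exact_mod_cast h2.trans (by omega)
  push_cast at h4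
  linarith

/-- Boundary expansion is monotone in the radius. [folklore] -/
theorem IsBoundaryExpander.mono {r r' c : ℝ} (h : IsBoundaryExpander S r c) (hr : r' ≤ r) :
    IsBoundaryExpander S r' c :=
  fun F hF => h F (hF.trans hr)

/-- A single index: boundary expansion with `c > 0` and `r ≥ 1` forces nonempty scopes. [folklore] -/
theorem IsBoundaryExpander.card_pos {r c : ℝ} (h : IsBoundaryExpander S r c) (hc : 0 < c)
    (hr : 1 ≤ r) (i : ι) : 0 < (S i).card := by
  have h1 := h {i} (by simpa using hr)
  have h2 : (boundary S {i}).card ≤ (S i).card :=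
    (Finset.card_le_card (boundary_subset_cover _)).trans (by simp [cover])
  have h3 : (0 : ℝ) < (boundary S {i}).card := by
    have : (0 : ℝ) < c * ({i} : Finset ι).card := by simp [hc]
    linarith
  have h4 : (0 : ℝ) < (S i).card := h3.trans_le (by exact_mod_cast h2)
  exact_mod_cast h4

end Expansion

/-! ### The KMOW random-graph theorem for `k`-SAT -/

/-- KMOW's constant `γ = (1/K) (β^{1/λ} / 2^{K/λ})^{C₀}` at `K = k`, `λ = k - 2`, with the universal
exponent `C₀` (the paper's `O(1)`). [Kothari–Mori–O'Donnell–Witmer 2017, Thm. 4.12] [cite: arXiv170104521, Thm. 4.12] -/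
def kmowGamma (C₀ : ℝ) (k : ℕ) (β : ℝ) : ℝ :=
  1 / (k : ℝ) * (β ^ (1 / ((k : ℝ) - 2)) / 2 ^ ((k : ℝ) / ((k : ℝ) - 2))) ^ C₀

/-- NAMED FACT (**Kothari–Mori–O'Donnell–Witmer 2017, Thm. 4.12, first claim, for `k`-SAT**;
proved in their Appendix A by the standard first-moment count). There is a universal constant
`C₀ > 0` such that for all `k ≥ 3` (`K = τ = k`, `λ = k - 2 ≥ 1`), all clause densities `Δ ∈ ℕ`
(`m = Δ n`), all `0 < ζ ≤ 0.99 (k - 2)`, `0 < β < 1/2`, and all `n` and `SMALL = nₛ` with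
`1 ≤ nₛ ≤ n/2`, `k ≤ ζ nₛ` (Notation 2.5) and `nₛ ≤ γ · n / Δ^{2/(k-2-ζ)}`,
`γ = kmowGamma C₀ k β`: except with probability at most `β` over `φ ∼ F_k(n, Δ n)`
(`randomKCNF`, i.i.d. uniform clauses on `k` distinct variables = KMOW's random factor graph with
random literal patterns), the Plausibility Assumption holds, which for `τ = k` (every
`τ`-subgraph contains all `k` edges of each of its constraints, Def. 4.5, and is plausible iff
`(k - ζ) c ≥ 2 (k c - v)`, Lemma 4.11 / §2.2) says: every family of at most `2 nₛ` clause
positions covers at least `(k + ζ)/2` variables per clause. Users take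
`(h : kmow_random_kCNF_plausible)`. [Kothari–Mori–O'Donnell–Witmer 2017, Thm. 4.12 with
Notation 2.5, §2.2, Def. 4.5, Lemma 4.11; Appendix A] [cite: arXiv170104521, Thm. 4.12] -/
def kmow_random_kCNF_plausible : Prop :=
  ∃ C₀ : ℝ, 0 < C₀ ∧ ∀ (k Δ : ℕ), 3 ≤ k → ∀ (ζ β : ℝ), 0 < ζ → ζ ≤ 0.99 * ((k : ℝ) - 2) →
    0 < β → β < 1 / 2 → ∀ (n nₛ : ℕ), 1 ≤ nₛ → 2 * (nₛ : ℝ) ≤ n → (k : ℝ) ≤ ζ * nₛ →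
      (nₛ : ℝ) ≤ kmowGamma C₀ k β * n / (Δ : ℝ) ^ (2 / ((k : ℝ) - 2 - ζ)) →
        1 - ENNReal.ofReal β ≤ (randomKCNF k n (Δ * n)).toOuterMeasure
          {φ | IsCoverExpander (cnfScopes φ) (2 * nₛ) (((k : ℝ) + ζ) / 2)}

/-- `kmowGamma C₀ k β > 0` for `k > 0` and `β > 0`. [folklore] -/
theorem kmowGamma_pos {C₀ : ℝ} {k : ℕ} {β : ℝ} (hk : 0 < k) (hβ : 0 < β) : 0 < kmowGamma C₀ k β := by
  unfold kmowGamma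
  have h1 : (0 : ℝ) < β ^ (1 / ((k : ℝ) - 2)) / 2 ^ ((k : ℝ) / ((k : ℝ) - 2)) := by positivity
  have h2 : (0 : ℝ) < 1 / (k : ℝ) := by positivity
  exact mul_pos h2 (Real.rpow_pos_of_pos h1 _)


end Literature.Computability.MetaComplexity
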